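import Summits.CriticalPhenomena.PercolationContinuityZ3.Theorems.PercNearOneGluingNoHeavyQuantNoGiantClosure
import Summits.CriticalPhenomena.PercolationContinuityZ3.Theorems.PercNearOneGluingNoHeavyQuantSliceConeForm
import HarnessLib

/-!
# QUANT lane R8, T-DEC: CONVOLUTION CLOSURE OF DEC WITH GIANTS, ONE-SIDED — `ConvClosedT` holds whenever ONE factor has, at the top
# layer, a datum without light straddlers relative to the other factor's top (from `SliceClosedWindowT`, now a theorem along two routes)

builds on p205010 (kernel theorem, internal audit signed; external expert review pending)

Support file (`--supports stmt-CriticalPhenomena-4575`), QUANT lane seat prim-quant-census-1 (gen 20), rung R8 of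
`run/shared/lean/prim/quant/LADDER.md`.  Theorems only, standard axioms, no sorries.  Memo
`run/shared/lean/prim/quant/prim-quant-census-1/CONV-G20.md`.

THE SETTING (lead g22's `LawDec.ConvClosedT`, `…QuantSliceConeForm`): floor `0 < x < 1`, probability laws `μ₁` on `{0..M₁}`, `μ₂` on `{0..M₂}`,
real targets `T₁, T₂`, a layer `j′`; `μ₁` is DEC(j″) at target `T₁` for every `j″ ≤ j′` with `j′ ≤ j″ + M₂` (the WINDOW); conclusion
`DECAtT x (T₁ + T₂) j′ (M₁ + M₂) (lconv M₁ M₂ μ₁ μ₂)`.  Typer g22's `…QuantConvHeavy` proved it in the HEAVY WORLD (`μ₁` heavy at every layer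
`≤ j′`, `μ₂` heavy at `j′`), typer g23's `…QuantNoGiantClosure` in the NO-GIANT regime.  With the window form of slice closure
(`LawDec.SliceClosedWindowT` — census-2 g55's `SliceLawSW` route, proved by typer g24 and independently by this seat's
`…QuantWindowPairLawSW`) the term-wise argument of `…QuantConvHeavy` now runs for a GENERAL window-DEC `μ₁`:
**if `μ₂` has a datum at `(T₂, j′)` WITHOUT LIGHT STRADDLERS relative to `M₁`** (`LawDec.BDECAtT x T₂ j′ M₂ M₁ μ₂`, typer g22: heavy
components, pairs with a self-sufficient `lo`, and light credit pairs `{lo, hi; γ}` with `hi + M₁ ≤ j′`), then the convolution is DEC(j′) at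
`T₁ + T₂`.  Term-wise over `μ₂`'s datum (`lconv_sum_right`, `lconv_TP`): a point `k` gives `shift_k μ₁` (the window datum of `μ₁` at layer `j′ − k`
+ the double shift bonus, or all giants); a (G) pair is criterion E inside the term (`shift_giant_decAtT`); a heavy credit pair `{lo, hi; g}` is
`shift_lo (slice μ₁ (hi−lo) g)` — `SliceClosedWindowT` at layer `j′ − lo` with the window `[j′ − hi, j′ − lo]` of `μ₁` (or the no-giant slice when
`M₁ + hi ≤ j′`), shifted; a light pair with `hi + M₁ ≤ j′` is the no-giant light slice `slice_light_decAtT_noGiant` shifted; a pair with self-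
sufficient `lo` is two point terms.  So `ConvClosedT` is reduced to its genuinely two-sided residue: BOTH factors have only data with light
straddlers (relative to each other) at the top layer — census-1 g20's exact census (memo §2: componentwise locality holds for every other
component type, 0 exceptions; fails only for straddling light pairs).

* `LawDec.shift_point_decAtT'`, `shift_pair_decAtT_window`, `shift_lightPair_decAtT_noStraddle`, `shift_selfPair_decAtT` — the terms.
* **`LawDec.lconv_decAtT_of_window_bdecAtT`** (`SliceClosedWindowT →` the one-sided conv closure), `lconv_decAtT_of_window_hdecAtT`.

[this work]; DEC rules ARCH-TREES-G49 §2.2 / DEC-TAMP-G50 §3.1 (this lane).  Nothing here is cited as a published result.  The gluing rows served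
[cite: KozmaNitzan2024, Conjecture 3 (p. 15)]; product measure [cite: Grimmett1999, §1.3 p. 10].
-/

noncomputable section

namespace Summit.CriticalPhenomena.PercolationContinuityZ3.Theorems

namespace Quant

open Finset

/-- the two-point law `{lo, hi; g}` (as in `…QuantLawDEC`) -/
local notation3 "TP[" lo ", " hi ", " g ", " h "]" =>
  (g : ℝ) * (if (h : ℕ) = (hi : ℕ) then (1 : ℝ) else 0) + (1 - (g : ℝ)) * (if (h : ℕ) = (lo : ℕ) then (1 : ℝ) else 0)

/-- the law `μ` shifted up by `s` (as in `…QuantConvHeavy`) -/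
local notation3 "SH[" μ ", " s ", " h "]" => (if (s : ℕ) ≤ (h : ℕ) then (μ : ℕ → ℝ) ((h : ℕ) - (s : ℕ)) else (0 : ℝ))

namespace LawDec

/-! ### The terms -/

/-- **(S)-term with a general datum**: `shift_k μ₁` is DEC(j′) at target `T₁ + T₂` when `k` is self-sufficient for `(T₂, j′)` — by the double
shift bonus from ANY datum of `μ₁` at layer `j′ − k` (`k ≤ j′`, `T₂ ≤ 2k`), or because it is carried by giants (`k > j′`). [this work] -/
theorem shift_point_decAtT' (x T₁ T₂ : ℝ) (j' M₁ M₂ k : ℕ) (μ₁ : ℕ → ℝ) (hx0 : 0 < x) (hx1 : x < 1) (h10 : ∀ h, 0 ≤ μ₁ h)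
    (h1M : ∀ h, M₁ < h → μ₁ h = 0) (h11 : ∑ h ∈ Finset.range (M₁ + 1), μ₁ h = 1) (hkM : k ≤ M₂)
    (hμ₁ : k ≤ j' → DECAtT x T₁ (j' - k) M₁ μ₁) (hS : T₂ ≤ 2 * (k : ℝ) ∨ j' + 1 ≤ k) :
    DECAtT x (T₁ + T₂) j' (M₁ + M₂) (fun h => SH[μ₁, k, h]) := by
  by_cases hkj : k ≤ j'
  · have h2k : T₂ ≤ 2 * (k : ℝ) := by
      rcases hS with h | h
      · exact h
      · omega
    have hd := decAtT_shift_two x T₁ (j' - k) M₁ k μ₁ (hμ₁ hkj)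
    rw [show j' - k + k = j' by omega] at hd
    exact decAtT_antitone_target (by linarith) (decAtT_mono_top hd (by omega))
  · exact decAtT_of_allGiants x _ j' (M₁ + M₂) _ hx0 hx1 (fun h => by split_ifs <;> [exact h10 _; exact le_rfl])
      (shift_eq_zero μ₁ M₁ k (M₁ + M₂) h1M (by omega)) (sum_shift_range μ₁ M₁ k (M₁ + M₂) h1M h11 (by omega))
      (fun h hh => by rw [if_neg (by omega)])

/-- **heavy (N)-term from the WINDOW**: `(1−g)·shift_lo μ₁ + g·shift_hi μ₁ = shift_lo (slice μ₁ (hi−lo) g)` with `lo < hi ≤ j′`, `x ≤ g ≤ 1`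
is DEC(j′) at every target `T′ ≤ T₁ + 2lo + (hi−lo)g`, given data of `μ₁` at the layers `[j′ − hi, j′ − lo]` — by `SliceClosedWindowT` at layer
`j′ − lo` (or the no-giant heavy slice when `M₁ + hi ≤ j′`) and the double shift bonus. [this work] -/
theorem shift_pair_decAtT_window (hW : SliceClosedWindowT) (x T₁ T' g : ℝ) (j' M₁ M₂ lo hi : ℕ) (μ₁ : ℕ → ℝ)
    (hx0 : 0 < x) (hx1 : x < 1) (h10 : ∀ h, 0 ≤ μ₁ h) (h1M : ∀ h, M₁ < h → μ₁ h = 0)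
    (h11 : ∑ h ∈ Finset.range (M₁ + 1), μ₁ h = 1) (hlt : lo < hi) (hhij : hi ≤ j') (hhi : hi ≤ M₂) (hxg : x ≤ g) (hg1 : g ≤ 1)
    (hwin : ∀ j'', j' - hi ≤ j'' → j'' ≤ j' - lo → DECAtT x T₁ j'' M₁ μ₁)
    (hT' : T' ≤ T₁ + 2 * (lo : ℝ) + ((hi : ℝ) - lo) * g) :
    DECAtT x T' j' (M₁ + M₂) (fun h => (1 - g) * SH[μ₁, lo, h] + g * SH[μ₁, hi, h]) := by
  obtain ⟨b, hb⟩ : ∃ b, hi = lo + b := ⟨hi - lo, by omega⟩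
  have hb1 : 1 ≤ b := by omega
  have hsl : DECAtT x (T₁ + (b : ℝ) * g) (j' - lo) (M₁ + b) (slice μ₁ b g) := by
    by_cases hng : M₁ + b ≤ j' - lo
    · exact slice_heavy_decAtT_noGiant x T₁ g (j' - lo) (j' - lo) M₁ b μ₁ hx0 hx1 hxg hg1 hb1 (by omega) hng
        (hwin (j' - lo) (by omega) le_rfl)
    · exact hW x g T₁ M₁ b (j' - lo) μ₁ hx0 hx1 hxg hg1 hb1 h10 h1M h11 (by omega)
        (fun j'' h1 h2 => hwin j'' (by omega) h1)
  have hsh := decAtT_shift_two x (T₁ + (b : ℝ) * g) (j' - lo) (M₁ + b) lo _ hsl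
  rw [show j' - lo + lo = j' by omega] at hsh
  have hfin := decAtT_antitone_target (show T' ≤ T₁ + (b : ℝ) * g + 2 * (lo : ℝ) by
    have : ((hi : ℝ) - lo) = b := by rw [hb]; push_cast; ring
    rw [this] at hT'; linarith) (decAtT_mono_top hsh (show M₁ + b + lo ≤ M₁ + M₂ by omega))
  have e : (fun h => if lo ≤ h then slice μ₁ b g (h - lo) else 0) = fun h => (1 - g) * SH[μ₁, lo, h] + g * SH[μ₁, hi, h] := by
    funext h; rw [shift_slice, hb]
  rw [e] at hfin
  exact hfin

/-- **light (N)-term WITHOUT STRADDLER**: a light credit pair `{lo, hi; γ}` of `μ₂` (`x² < γ < x`) with `hi + M₁ ≤ j′` turns `μ₁` into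
`shift_lo (slice μ₁ (hi−lo) γ)` whose top `M₁ + hi` stays below the layer: the no-giant light slice (`slice_light_decAtT_noGiant`) at layer
`j′ − lo` from the datum of `μ₁` there, and the double shift bonus; target `T′ ≤ T₁ + 2lo + (hi−lo)·(γ−x²)/(1−x)`. [this work] -/
theorem shift_lightPair_decAtT_noStraddle (x T₁ T' γ : ℝ) (j' M₁ M₂ lo hi : ℕ) (μ₁ : ℕ → ℝ) (hx0 : 0 < x) (hx1 : x < 1)
    (hlt : lo < hi) (hhi : hi ≤ M₂) (hγ0 : x ^ 2 < γ) (hγx : γ < x) (hstr : hi + M₁ ≤ j')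
    (hμ₁ : DECAtT x T₁ (j' - lo) M₁ μ₁) (hT' : T' ≤ T₁ + 2 * (lo : ℝ) + ((hi : ℝ) - lo) * ((γ - x ^ 2) / (1 - x))) :
    DECAtT x T' j' (M₁ + M₂) (fun h => (1 - γ) * SH[μ₁, lo, h] + γ * SH[μ₁, hi, h]) := by
  obtain ⟨b, hb⟩ : ∃ b, hi = lo + b := ⟨hi - lo, by omega⟩
  have hb1 : 1 ≤ b := by omega
  have hsl := slice_light_decAtT_noGiant x T₁ γ (j' - lo) (j' - lo) M₁ b μ₁ hx0 hx1 hγ0 hγx hb1 (by omega) (by omega) hμ₁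
  have hsh := decAtT_shift_two x (T₁ + (b : ℝ) * ((γ - x ^ 2) / (1 - x))) (j' - lo) (M₁ + b) lo _ hsl
  rw [show j' - lo + lo = j' by omega] at hsh
  have hfin := decAtT_antitone_target (show T' ≤ T₁ + (b : ℝ) * ((γ - x ^ 2) / (1 - x)) + 2 * (lo : ℝ) by
    have : ((hi : ℝ) - lo) = b := by rw [hb]; push_cast; ring
    rw [this] at hT'; linarith) (decAtT_mono_top hsh (show M₁ + b + lo ≤ M₁ + M₂ by omega))
  have e : (fun h => if lo ≤ h then slice μ₁ b γ (h - lo) else 0) = fun h => (1 - γ) * SH[μ₁, lo, h] + γ * SH[μ₁, hi, h] := by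
    funext h; rw [shift_slice, hb]
  rw [e] at hfin
  exact hfin

/-- **pair with a self-sufficient `lo`** (`T₂ ≤ 2lo` or `lo > j′`, any gate `g ∈ [0,1]`): both shifted copies are (S)-terms. [this work] -/
theorem shift_selfPair_decAtT (x T₁ T₂ g : ℝ) (j' M₁ M₂ lo hi : ℕ) (μ₁ : ℕ → ℝ) (hx0 : 0 < x) (hx1 : x < 1) (h10 : ∀ h, 0 ≤ μ₁ h)
    (h1M : ∀ h, M₁ < h → μ₁ h = 0) (h11 : ∑ h ∈ Finset.range (M₁ + 1), μ₁ h = 1) (hlohi : lo ≤ hi) (hhi : hi ≤ M₂)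
    (hg : 0 ≤ g ∧ g ≤ 1) (hS : T₂ ≤ 2 * (lo : ℝ) ∨ j' + 1 ≤ lo)
    (hwin : ∀ j'', j'' ≤ j' → j' ≤ j'' + M₂ → DECAtT x T₁ j'' M₁ μ₁) :
    DECAtT x (T₁ + T₂) j' (M₁ + M₂) (fun h => (1 - g) * SH[μ₁, lo, h] + g * SH[μ₁, hi, h]) := by
  have hlo := shift_point_decAtT' x T₁ T₂ j' M₁ M₂ lo μ₁ hx0 hx1 h10 h1M h11 (hlohi.trans hhi)
    (fun hk => hwin (j' - lo) (by omega) (by omega)) hS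
  have hhi' := shift_point_decAtT' x T₁ T₂ j' M₁ M₂ hi μ₁ hx0 hx1 h10 h1M h11 hhi
    (fun hk => hwin (j' - hi) (by omega) (by omega)) (by
      rcases hS with h | h
      · left; have : (lo : ℝ) ≤ hi := by exact_mod_cast hlohi
        linarith
      · right; omega)
  have := decAtT_mixture (1 - g) (by linarith [hg.2]) (by linarith [hg.1]) hlo hhi'
  have e : (fun h => (1 - g) * SH[μ₁, lo, h] + (1 - (1 - g)) * SH[μ₁, hi, h])
      = fun h => (1 - g) * SH[μ₁, lo, h] + g * SH[μ₁, hi, h] := by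
    funext h; ring
  rw [e] at this
  exact this

/-! ### The theorem -/

/-- **ONE-SIDED CONVOLUTION CLOSURE OF DEC (from `SliceClosedWindowT`).**  Floor `0 < x < 1`; `μ₁ ≥ 0` a probability law on `{0..M₁}` that is
DEC at target `T₁` at every layer of the window `[j′ − M₂, j′]`; `μ₂` with a datum at `(T₂, j′)` WITHOUT LIGHT STRADDLERS relative to `M₁`
(`BDECAtT x T₂ j′ M₂ M₁ μ₂`: heavy components, pairs with self-sufficient `lo`, light credit pairs with `hi + M₁ ≤ j′`).  Then
`lconv M₁ M₂ μ₁ μ₂` is DEC(j′) at target `T₁ + T₂` on `{0..M₁+M₂}`. [this work] -/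
theorem lconv_decAtT_of_window_bdecAtT (hW : SliceClosedWindowT) (x T₁ T₂ : ℝ) (j' M₁ M₂ : ℕ) (μ₁ μ₂ : ℕ → ℝ)
    (hx0 : 0 < x) (hx1 : x < 1)
    (h10 : ∀ h, 0 ≤ μ₁ h) (h1M : ∀ h, M₁ < h → μ₁ h = 0) (h11 : ∑ h ∈ Finset.range (M₁ + 1), μ₁ h = 1)
    (hwin : ∀ j'', j'' ≤ j' → j' ≤ j'' + M₂ → DECAtT x T₁ j'' M₁ μ₁) (hμ₂ : BDECAtT x T₂ j' M₂ M₁ μ₂) :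
    DECAtT x (T₁ + T₂) j' (M₁ + M₂) (lconv M₁ M₂ μ₁ μ₂) := by
  classical
  obtain ⟨ρ, hρ, lam, gg, lo, hi, h0, h1, hgg, hlohi, hhi, hμ, hval⟩ := hμ₂
  have hmix : ∀ t, lconv M₁ M₂ μ₁ μ₂ t = ∑ r, lam r * lconv M₁ M₂ μ₁ (fun k => TP[lo r, hi r, gg r, k]) t := by
    intro t
    rw [← lconv_sum_right]
    simp only [lconv]
    refine Finset.sum_congr rfl fun i _ => Finset.sum_congr rfl fun k _ => ?_
    rw [hμ k]
  refine decAtT_finite_mixture x _ j' (M₁ + M₂) _ lam (fun r => lconv M₁ M₂ μ₁ (fun k => TP[lo r, hi r, gg r, k]))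
    h0 h1 hmix fun r hr => ?_
  have e : lconv M₁ M₂ μ₁ (fun k => TP[lo r, hi r, gg r, k]) = fun h => (1 - gg r) * SH[μ₁, lo r, h] + gg r * SH[μ₁, hi r, h] := by
    funext h; exact lconv_TP M₁ M₂ (lo r) (hi r) μ₁ (gg r) h1M ((hlohi r).trans (hhi r)) (hhi r) h
  rw [e]
  rcases hval r hr with hH | ⟨hlt, hS⟩ | ⟨hlt, hstr, hγ0, hγx, hcr⟩
  · -- heavy components: (S), (G), heavy (N)
    rcases hH with ⟨heq, hS⟩ | ⟨hlt, hj, hxγ⟩ | ⟨hlt, hhij, hxγ, hcr⟩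
    · have e2 : (fun h => (1 - gg r) * SH[μ₁, lo r, h] + gg r * SH[μ₁, hi r, h]) = fun h => SH[μ₁, lo r, h] := by
        funext h; rw [heq]; ring
      rw [e2]
      exact shift_point_decAtT' x T₁ T₂ j' M₁ M₂ (lo r) μ₁ hx0 hx1 h10 h1M h11 ((hlohi r).trans (hhi r))
        (fun hk => hwin (j' - lo r) (by omega) (by have := (hlohi r).trans (hhi r); omega)) hS
    · exact shift_giant_decAtT x _ j' M₁ M₂ (lo r) (hi r) μ₁ (gg r) hx0 hx1 h10 h1M h11 ((hlohi r).trans (hhi r)) (hhi r) hj hxγ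
        (hgg r).2
    · exact shift_pair_decAtT_window hW x T₁ _ (gg r) j' M₁ M₂ (lo r) (hi r) μ₁ hx0 hx1 h10 h1M h11 hlt hhij (hhi r) hxγ (hgg r).2
        (fun j'' ha hb => hwin j'' (by omega) (by have := hhi r; omega)) (by linarith)
  · -- pair with self-sufficient lo
    exact shift_selfPair_decAtT x T₁ T₂ (gg r) j' M₁ M₂ (lo r) (hi r) μ₁ hx0 hx1 h10 h1M h11 hlt.le (hhi r) (hgg r) hS hwin
  · -- light pair without straddler
    exact shift_lightPair_decAtT_noStraddle x T₁ _ (gg r) j' M₁ M₂ (lo r) (hi r) μ₁ hx0 hx1 hlt (hhi r) hγ0 hγx hstr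
      (hwin (j' - lo r) (by omega) (by have := (hlohi r).trans (hhi r); omega)) (by linarith)

/-- **in particular for a HEAVY datum of `μ₂` at `j′`** (and a general window-DEC `μ₁`): `…QuantConvHeavy`'s `lconv_decAtT_of_hdecAtT` with
its hypothesis "`μ₁` heavy at every layer `≤ j′`" weakened to "`μ₁` DEC on the window `[j′ − M₂, j′]`". [this work] -/
theorem lconv_decAtT_of_window_hdecAtT (hW : SliceClosedWindowT) (x T₁ T₂ : ℝ) (j' M₁ M₂ : ℕ) (μ₁ μ₂ : ℕ → ℝ)
    (hx0 : 0 < x) (hx1 : x < 1)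
    (h10 : ∀ h, 0 ≤ μ₁ h) (h1M : ∀ h, M₁ < h → μ₁ h = 0) (h11 : ∑ h ∈ Finset.range (M₁ + 1), μ₁ h = 1)
    (hwin : ∀ j'', j'' ≤ j' → j' ≤ j'' + M₂ → DECAtT x T₁ j'' M₁ μ₁) (hμ₂ : HDECAtT x T₂ j' M₂ μ₂) :
    DECAtT x (T₁ + T₂) j' (M₁ + M₂) (lconv M₁ M₂ μ₁ μ₂) :=
  lconv_decAtT_of_window_bdecAtT hW x T₁ T₂ j' M₁ M₂ μ₁ μ₂ hx0 hx1 h10 h1M h11 hwin (hμ₂.bdecAtT M₁)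

end LawDec

end Quant

end Summit.CriticalPhenomena.PercolationContinuityZ3.Theorems
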